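import Summits.BirchSwinnertonDyer.Rank1Residual.P2.CongruentNumberPairsAtTwo
import HarnessLib

/-!
# Sub-lane «bsd-p2»: PAIRS `(E_n, 2)` CLOSED IN THE KERNEL — instances, odd `n ∈ U_CN` with
# `s(n) = 0` (17 pairs; journal door of `P2/CongruentNumberPairsAtTwo.lean`)

HONEST FRAMING (sub-lane «bsd-p2», run/shared/lean/b2b/bsd-rank1-residual/p2/, verbatim in every
file): the target of record is the FULL Birch–Swinnerton-Dyer formula for EVERY analytic-rank `≤ 1`
`E/ℚ` at ALL primes INCLUDING `2`; the odd-prime class ledger is referee A's; the `2`-part is OPEN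
(cells O1 = X5 ∖ CM and O12 = the CM corner) and under census by «bsd-p2». Census / instrument
output at `2` = EVIDENCE / conjecture items with held-out validation, NEVER a Literature fact;
certificates close PAIRS (one isogeny class, `p = 2`), never classes. This file asserts NO
arithmetic fact. For each odd square-free `n` of the in-range congruent-number universe `U_CN`
(conductor `32n²`/`16n² < 5·10⁵`; p2-monsky-eng's `p2/monsky/eng/dry/step0-bypro/U_CN.tsv`) with
Monsky Selmer rank `s(n) = 0` (ibid. `U_CN.minor-certs.tsv` @1193270bf93bd68b, column `det_M = 1`;
17 rows of this parity), the kernel re-derives Monsky's matrix ENTRY BY ENTRY (`norm_num` on the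
Jacobi symbols; the rows agree with monsky-eng's `matrix_rows(bits)` column, an independent
implementation), checks `det M = 1` by `decide`, and concludes `BSD(E_n, 2)` through the JOURNAL door
`bsdp_two_congruentNumberCurve_of_det_odd` — modulo the named facts Monsky 1994, Burungale–Tian
2026 Thm 1.1, Deuring–Hecke, Burungale–Flach 2024 Cor 2, all as binders; the [PRE] door (Smith 2016
Cor 1.3, `…_of_det_odd_smith`) closes the same pairs from the same determinant lemmas. Cells:
`coveredC8` (§3 of the door file) — pairs, not classes; the census word is the lead's (U-25). Nothing
booked; no mark moved. Unit `b2b-bsdres-p2-typer` GEN 3 (p2-lead T-25 / ME-6); NEW file. References: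
[HeathBrown1994SelmerCongruentII] Appendix (Monsky); [BurungaleTian2026] Thm 1.1; [BurungaleFlach2024]
Cor 2; [Miller2011LMS] Def 1.1; HOME/p2/monsky/eng/dry/step0-bypro/U_CN.minor-certs.tsv.
-/

noncomputable section

open scoped Classical

open Matrix WeierstrassCurve Literature.NumberTheory.EllipticCurves
  Literature.NumberTheory.EllipticCurves.HeathBrown1994

set_option autoImplicit false

namespace Summit.BirchSwinnertonDyer.Rank1Residual.P2

/-- `n = 1`: `n ≡ 1 (mod 8)`, Cremona class of `E_{1}` = `32a2` (`N = 32`); Monsky's matrix (odd case, `k = 0`) has rows `(empty)` and `det M = 1`, i.e. `s(1) = 0`. [cite: HeathBrown1994SelmerCongruentII, Appendix (Monsky), typescript p. 39 L10–L33] -/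
theorem det_monskyMatrixOdd_1 : (monskyMatrixOdd (![] : Fin 0 → ℕ)).det = 1 := by decide

/-- **`BSD(E_{1}, 2)`** (`y² = x³ − 1²x`, class `32a2`), journal door: Monsky (`hM`) + Burungale–Tian (`hBT`) + Deuring–Hecke (`hH`) + Burungale–Flach (`hBF`); membership `s(1) = 0` by `det_monskyMatrixOdd_1`. [cite: BurungaleTian2026, Thm. 1.1] [cite: BurungaleFlach2024, Cor. 2] [cite: Miller2011LMS, Def. 1.1] -/
theorem bsdp_two_congruentNumberCurve_1 (hM : monsky_card_selmerGroup_two_odd)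
    (hBT : burungaleTian_analyticRank_eq_zero_of_selmerCorank_eq_zero_of_hasCM)
    (hH : hasEntireLFunction_of_j_mem_maximalCMJInvariants)
    (hBF : bsdTriple_of_hasCM_of_L_one_ne_zero) : BSDp (congruentNumberCurve 1) 2 :=
  bsdp_two_congruentNumberCurve_of_det_odd (![] : Fin 0 → ℕ) hM hBT hH hBF (fun i => i.elim0) (fun i => i.elim0)
    (Function.injective_of_subsingleton _) det_monskyMatrixOdd_1 (by simp)

/-- `n = 3` = 3: `n ≡ 3 (mod 8)`, Cremona class of `E_{3}` = `288d1` (`N = 288`); Monsky's matrix (odd case, `k = 1`) has rows `11;10` and `det M = 1`, i.e. `s(3) = 0`. [cite: HeathBrown1994SelmerCongruentII, Appendix (Monsky), typescript p. 39 L10–L33] -/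
theorem det_monskyMatrixOdd_3 : (monskyMatrixOdd ![3]).det = 1 := by
  have e : monskyMatrixOdd ![3] =
      Matrix.fromBlocks !![1] !![1] !![1] !![0] := by
    ext i j
    fin_cases i <;> fin_cases j <;>
      norm_num [monskyMatrixOdd, legendreMatrix, legendreDiagonal, addLegendreSym,
        Matrix.fromBlocks, Finset.sum_erase_eq_sub, Fin.sum_univ_succ, Matrix.cons_val_succ,
        Matrix.cons_val_zero, CharTwo.two_eq_zero, three_eq_one_zmod_two]
  rw [e]; decide

/-- **`BSD(E_{3}, 2)`** (`y² = x³ − 3²x`, class `288d1`), journal door: Monsky (`hM`) + Burungale–Tian (`hBT`) + Deuring–Hecke (`hH`) + Burungale–Flach (`hBF`); membership `s(3) = 0` by `det_monskyMatrixOdd_3`. [cite: BurungaleTian2026, Thm. 1.1] [cite: BurungaleFlach2024, Cor. 2] [cite: Miller2011LMS, Def. 1.1] -/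
theorem bsdp_two_congruentNumberCurve_3 (hM : monsky_card_selmerGroup_two_odd)
    (hBT : burungaleTian_analyticRank_eq_zero_of_selmerCorank_eq_zero_of_hasCM)
    (hH : hasEntireLFunction_of_j_mem_maximalCMJInvariants)
    (hBF : bsdTriple_of_hasCM_of_L_one_ne_zero) : BSDp (congruentNumberCurve 3) 2 :=
  bsdp_two_congruentNumberCurve_of_det_odd ![3] hM hBT hH hBF
    (by intro i; fin_cases i; norm_num) (by intro i; fin_cases i; decide) (by decide)
    det_monskyMatrixOdd_3 (by simp)

/-- `n = 11` = 11: `n ≡ 3 (mod 8)`, Cremona class of `E_{11}` = `3872b1` (`N = 3872`); Monsky's matrix (odd case, `k = 1`) has rows `11;10` and `det M = 1`, i.e. `s(11) = 0`. [cite: HeathBrown1994SelmerCongruentII, Appendix (Monsky), typescript p. 39 L10–L33] -/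
theorem det_monskyMatrixOdd_11 : (monskyMatrixOdd ![11]).det = 1 := by
  have e : monskyMatrixOdd ![11] =
      Matrix.fromBlocks !![1] !![1] !![1] !![0] := by
    ext i j
    fin_cases i <;> fin_cases j <;>
      norm_num [monskyMatrixOdd, legendreMatrix, legendreDiagonal, addLegendreSym,
        Matrix.fromBlocks, Finset.sum_erase_eq_sub, Fin.sum_univ_succ, Matrix.cons_val_succ,
        Matrix.cons_val_zero, CharTwo.two_eq_zero, three_eq_one_zmod_two]
  rw [e]; decide

/-- **`BSD(E_{11}, 2)`** (`y² = x³ − 11²x`, class `3872b1`), journal door: Monsky (`hM`) + Burungale–Tian (`hBT`) + Deuring–Hecke (`hH`) + Burungale–Flach (`hBF`); membership `s(11) = 0` by `det_monskyMatrixOdd_11`. [cite: BurungaleTian2026, Thm. 1.1] [cite: BurungaleFlach2024, Cor. 2] [cite: Miller2011LMS, Def. 1.1] -/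
theorem bsdp_two_congruentNumberCurve_11 (hM : monsky_card_selmerGroup_two_odd)
    (hBT : burungaleTian_analyticRank_eq_zero_of_selmerCorank_eq_zero_of_hasCM)
    (hH : hasEntireLFunction_of_j_mem_maximalCMJInvariants)
    (hBF : bsdTriple_of_hasCM_of_L_one_ne_zero) : BSDp (congruentNumberCurve 11) 2 :=
  bsdp_two_congruentNumberCurve_of_det_odd ![11] hM hBT hH hBF
    (by intro i; fin_cases i; norm_num) (by intro i; fin_cases i; decide) (by decide)
    det_monskyMatrixOdd_11 (by simp)

/-- `n = 19` = 19: `n ≡ 3 (mod 8)`, Cremona class of `E_{19}` = `11552h1` (`N = 11552`); Monsky's matrix (odd case, `k = 1`) has rows `11;10` and `det M = 1`, i.e. `s(19) = 0`. [cite: HeathBrown1994SelmerCongruentII, Appendix (Monsky), typescript p. 39 L10–L33] -/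
theorem det_monskyMatrixOdd_19 : (monskyMatrixOdd ![19]).det = 1 := by
  have e : monskyMatrixOdd ![19] =
      Matrix.fromBlocks !![1] !![1] !![1] !![0] := by
    ext i j
    fin_cases i <;> fin_cases j <;>
      norm_num [monskyMatrixOdd, legendreMatrix, legendreDiagonal, addLegendreSym,
        Matrix.fromBlocks, Finset.sum_erase_eq_sub, Fin.sum_univ_succ, Matrix.cons_val_succ,
        Matrix.cons_val_zero, CharTwo.two_eq_zero, three_eq_one_zmod_two]
  rw [e]; decide

/-- **`BSD(E_{19}, 2)`** (`y² = x³ − 19²x`, class `11552h1`), journal door: Monsky (`hM`) + Burungale–Tian (`hBT`) + Deuring–Hecke (`hH`) + Burungale–Flach (`hBF`); membership `s(19) = 0` by `det_monskyMatrixOdd_19`. [cite: BurungaleTian2026, Thm. 1.1] [cite: BurungaleFlach2024, Cor. 2] [cite: Miller2011LMS, Def. 1.1] -/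
theorem bsdp_two_congruentNumberCurve_19 (hM : monsky_card_selmerGroup_two_odd)
    (hBT : burungaleTian_analyticRank_eq_zero_of_selmerCorank_eq_zero_of_hasCM)
    (hH : hasEntireLFunction_of_j_mem_maximalCMJInvariants)
    (hBF : bsdTriple_of_hasCM_of_L_one_ne_zero) : BSDp (congruentNumberCurve 19) 2 :=
  bsdp_two_congruentNumberCurve_of_det_odd ![19] hM hBT hH hBF
    (by intro i; fin_cases i; norm_num) (by intro i; fin_cases i; decide) (by decide)
    det_monskyMatrixOdd_19 (by simp)

/-- `n = 33` = 3 · 11: `n ≡ 1 (mod 8)`, Cremona class of `E_{33}` = `34848ca1` (`N = 34848`); Monsky's matrix (odd case, `k = 2`) has rows `0110;0101;1011;0100` and `det M = 1`, i.e. `s(33) = 0`. [cite: HeathBrown1994SelmerCongruentII, Appendix (Monsky), typescript p. 39 L10–L33] -/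
theorem det_monskyMatrixOdd_33 : (monskyMatrixOdd ![3, 11]).det = 1 := by
  have e : monskyMatrixOdd ![3, 11] =
      Matrix.fromBlocks !![0, 1; 0, 1] !![1, 0; 0, 1] !![1, 0; 0, 1] !![1, 1; 0, 0] := by
    ext i j
    fin_cases i <;> fin_cases j <;>
      norm_num [monskyMatrixOdd, legendreMatrix, legendreDiagonal, addLegendreSym,
        Matrix.fromBlocks, Finset.sum_erase_eq_sub, Fin.sum_univ_succ, Matrix.cons_val_succ,
        Matrix.cons_val_zero, CharTwo.two_eq_zero, three_eq_one_zmod_two]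
    decide
  rw [e]; decide

/-- **`BSD(E_{33}, 2)`** (`y² = x³ − 33²x`, class `34848ca1`), journal door: Monsky (`hM`) + Burungale–Tian (`hBT`) + Deuring–Hecke (`hH`) + Burungale–Flach (`hBF`); membership `s(33) = 0` by `det_monskyMatrixOdd_33`. [cite: BurungaleTian2026, Thm. 1.1] [cite: BurungaleFlach2024, Cor. 2] [cite: Miller2011LMS, Def. 1.1] -/
theorem bsdp_two_congruentNumberCurve_33 (hM : monsky_card_selmerGroup_two_odd)
    (hBT : burungaleTian_analyticRank_eq_zero_of_selmerCorank_eq_zero_of_hasCM)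
    (hH : hasEntireLFunction_of_j_mem_maximalCMJInvariants)
    (hBF : bsdTriple_of_hasCM_of_L_one_ne_zero) : BSDp (congruentNumberCurve 33) 2 :=
  bsdp_two_congruentNumberCurve_of_det_odd ![3, 11] hM hBT hH hBF
    (by intro i; fin_cases i <;> norm_num) (by intro i; fin_cases i <;> decide) (by decide)
    det_monskyMatrixOdd_33 (by simp [Fin.prod_univ_succ])

/-- `n = 35` = 5 · 7: `n ≡ 3 (mod 8)`, Cremona class of `E_{35}` = `39200f1` (`N = 39200`); Monsky's matrix (odd case, `k = 2`) has rows `0110;1100;1001;0010` and `det M = 1`, i.e. `s(35) = 0`. [cite: HeathBrown1994SelmerCongruentII, Appendix (Monsky), typescript p. 39 L10–L33] -/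
theorem det_monskyMatrixOdd_35 : (monskyMatrixOdd ![5, 7]).det = 1 := by
  have e : monskyMatrixOdd ![5, 7] =
      Matrix.fromBlocks !![0, 1; 1, 1] !![1, 0; 0, 0] !![1, 0; 0, 0] !![0, 1; 1, 0] := by
    ext i j
    fin_cases i <;> fin_cases j <;>
      norm_num [monskyMatrixOdd, legendreMatrix, legendreDiagonal, addLegendreSym,
        Matrix.fromBlocks, Finset.sum_erase_eq_sub, Fin.sum_univ_succ, Matrix.cons_val_succ,
        Matrix.cons_val_zero, CharTwo.two_eq_zero, three_eq_one_zmod_two] <;> decide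
  rw [e]; decide

/-- **`BSD(E_{35}, 2)`** (`y² = x³ − 35²x`, class `39200f1`), journal door: Monsky (`hM`) + Burungale–Tian (`hBT`) + Deuring–Hecke (`hH`) + Burungale–Flach (`hBF`); membership `s(35) = 0` by `det_monskyMatrixOdd_35`. [cite: BurungaleTian2026, Thm. 1.1] [cite: BurungaleFlach2024, Cor. 2] [cite: Miller2011LMS, Def. 1.1] -/
theorem bsdp_two_congruentNumberCurve_35 (hM : monsky_card_selmerGroup_two_odd)
    (hBT : burungaleTian_analyticRank_eq_zero_of_selmerCorank_eq_zero_of_hasCM)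
    (hH : hasEntireLFunction_of_j_mem_maximalCMJInvariants)
    (hBF : bsdTriple_of_hasCM_of_L_one_ne_zero) : BSDp (congruentNumberCurve 35) 2 :=
  bsdp_two_congruentNumberCurve_of_det_odd ![5, 7] hM hBT hH hBF
    (by intro i; fin_cases i <;> norm_num) (by intro i; fin_cases i <;> decide) (by decide)
    det_monskyMatrixOdd_35 (by simp [Fin.prod_univ_succ])

/-- `n = 43` = 43: `n ≡ 3 (mod 8)`, Cremona class of `E_{43}` = `59168e1` (`N = 59168`); Monsky's matrix (odd case, `k = 1`) has rows `11;10` and `det M = 1`, i.e. `s(43) = 0`. [cite: HeathBrown1994SelmerCongruentII, Appendix (Monsky), typescript p. 39 L10–L33] -/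
theorem det_monskyMatrixOdd_43 : (monskyMatrixOdd ![43]).det = 1 := by
  have e : monskyMatrixOdd ![43] =
      Matrix.fromBlocks !![1] !![1] !![1] !![0] := by
    ext i j
    fin_cases i <;> fin_cases j <;>
      norm_num [monskyMatrixOdd, legendreMatrix, legendreDiagonal, addLegendreSym,
        Matrix.fromBlocks, Finset.sum_erase_eq_sub, Fin.sum_univ_succ, Matrix.cons_val_succ,
        Matrix.cons_val_zero, CharTwo.two_eq_zero, three_eq_one_zmod_two]
  rw [e]; decide

/-- **`BSD(E_{43}, 2)`** (`y² = x³ − 43²x`, class `59168e1`), journal door: Monsky (`hM`) + Burungale–Tian (`hBT`) + Deuring–Hecke (`hH`) + Burungale–Flach (`hBF`); membership `s(43) = 0` by `det_monskyMatrixOdd_43`. [cite: BurungaleTian2026, Thm. 1.1] [cite: BurungaleFlach2024, Cor. 2] [cite: Miller2011LMS, Def. 1.1] -/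
theorem bsdp_two_congruentNumberCurve_43 (hM : monsky_card_selmerGroup_two_odd)
    (hBT : burungaleTian_analyticRank_eq_zero_of_selmerCorank_eq_zero_of_hasCM)
    (hH : hasEntireLFunction_of_j_mem_maximalCMJInvariants)
    (hBF : bsdTriple_of_hasCM_of_L_one_ne_zero) : BSDp (congruentNumberCurve 43) 2 :=
  bsdp_two_congruentNumberCurve_of_det_odd ![43] hM hBT hH hBF
    (by intro i; fin_cases i; norm_num) (by intro i; fin_cases i; decide) (by decide)
    det_monskyMatrixOdd_43 (by simp)

/-- `n = 51` = 3 · 17: `n ≡ 3 (mod 8)`, Cremona class of `E_{51}` = `83232n1` (`N = 83232`); Monsky's matrix (odd case, `k = 2`) has rows `0110;1100;1011;0011` and `det M = 1`, i.e. `s(51) = 0`. [cite: HeathBrown1994SelmerCongruentII, Appendix (Monsky), typescript p. 39 L10–L33] -/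
theorem det_monskyMatrixOdd_51 : (monskyMatrixOdd ![3, 17]).det = 1 := by
  have e : monskyMatrixOdd ![3, 17] =
      Matrix.fromBlocks !![0, 1; 1, 1] !![1, 0; 0, 0] !![1, 0; 0, 0] !![1, 1; 1, 1] := by
    ext i j
    fin_cases i <;> fin_cases j <;>
      norm_num [monskyMatrixOdd, legendreMatrix, legendreDiagonal, addLegendreSym,
        Matrix.fromBlocks, Finset.sum_erase_eq_sub, Fin.sum_univ_succ, Matrix.cons_val_succ,
        Matrix.cons_val_zero, CharTwo.two_eq_zero, three_eq_one_zmod_two]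
    decide
  rw [e]; decide

/-- **`BSD(E_{51}, 2)`** (`y² = x³ − 51²x`, class `83232n1`), journal door: Monsky (`hM`) + Burungale–Tian (`hBT`) + Deuring–Hecke (`hH`) + Burungale–Flach (`hBF`); membership `s(51) = 0` by `det_monskyMatrixOdd_51`. [cite: BurungaleTian2026, Thm. 1.1] [cite: BurungaleFlach2024, Cor. 2] [cite: Miller2011LMS, Def. 1.1] -/
theorem bsdp_two_congruentNumberCurve_51 (hM : monsky_card_selmerGroup_two_odd)
    (hBT : burungaleTian_analyticRank_eq_zero_of_selmerCorank_eq_zero_of_hasCM)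
    (hH : hasEntireLFunction_of_j_mem_maximalCMJInvariants)
    (hBF : bsdTriple_of_hasCM_of_L_one_ne_zero) : BSDp (congruentNumberCurve 51) 2 :=
  bsdp_two_congruentNumberCurve_of_det_odd ![3, 17] hM hBT hH hBF
    (by intro i; fin_cases i <;> norm_num) (by intro i; fin_cases i <;> decide) (by decide)
    det_monskyMatrixOdd_51 (by simp [Fin.prod_univ_succ])

/-- `n = 57` = 3 · 19: `n ≡ 1 (mod 8)`, Cremona class of `E_{57}` = `103968bz1` (`N = 103968`); Monsky's matrix (odd case, `k = 2`) has rows `1010;1001;1000;0111` and `det M = 1`, i.e. `s(57) = 0`. [cite: HeathBrown1994SelmerCongruentII, Appendix (Monsky), typescript p. 39 L10–L33] -/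
theorem det_monskyMatrixOdd_57 : (monskyMatrixOdd ![3, 19]).det = 1 := by
  have e : monskyMatrixOdd ![3, 19] =
      Matrix.fromBlocks !![1, 0; 1, 0] !![1, 0; 0, 1] !![1, 0; 0, 1] !![0, 0; 1, 1] := by
    ext i j
    fin_cases i <;> fin_cases j <;>
      norm_num [monskyMatrixOdd, legendreMatrix, legendreDiagonal, addLegendreSym,
        Matrix.fromBlocks, Finset.sum_erase_eq_sub, Fin.sum_univ_succ, Matrix.cons_val_succ,
        Matrix.cons_val_zero, CharTwo.two_eq_zero, three_eq_one_zmod_two]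
    decide
  rw [e]; decide

/-- **`BSD(E_{57}, 2)`** (`y² = x³ − 57²x`, class `103968bz1`), journal door: Monsky (`hM`) + Burungale–Tian (`hBT`) + Deuring–Hecke (`hH`) + Burungale–Flach (`hBF`); membership `s(57) = 0` by `det_monskyMatrixOdd_57`. [cite: BurungaleTian2026, Thm. 1.1] [cite: BurungaleFlach2024, Cor. 2] [cite: Miller2011LMS, Def. 1.1] -/
theorem bsdp_two_congruentNumberCurve_57 (hM : monsky_card_selmerGroup_two_odd)
    (hBT : burungaleTian_analyticRank_eq_zero_of_selmerCorank_eq_zero_of_hasCM)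
    (hH : hasEntireLFunction_of_j_mem_maximalCMJInvariants)
    (hBF : bsdTriple_of_hasCM_of_L_one_ne_zero) : BSDp (congruentNumberCurve 57) 2 :=
  bsdp_two_congruentNumberCurve_of_det_odd ![3, 19] hM hBT hH hBF
    (by intro i; fin_cases i <;> norm_num) (by intro i; fin_cases i <;> decide) (by decide)
    det_monskyMatrixOdd_57 (by simp [Fin.prod_univ_succ])

/-- `n = 59` = 59: `n ≡ 3 (mod 8)`, Cremona class of `E_{59}` = `111392b1` (`N = 111392`); Monsky's matrix (odd case, `k = 1`) has rows `11;10` and `det M = 1`, i.e. `s(59) = 0`. [cite: HeathBrown1994SelmerCongruentII, Appendix (Monsky), typescript p. 39 L10–L33] -/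
theorem det_monskyMatrixOdd_59 : (monskyMatrixOdd ![59]).det = 1 := by
  have e : monskyMatrixOdd ![59] =
      Matrix.fromBlocks !![1] !![1] !![1] !![0] := by
    ext i j
    fin_cases i <;> fin_cases j <;>
      norm_num [monskyMatrixOdd, legendreMatrix, legendreDiagonal, addLegendreSym,
        Matrix.fromBlocks, Finset.sum_erase_eq_sub, Fin.sum_univ_succ, Matrix.cons_val_succ,
        Matrix.cons_val_zero, CharTwo.two_eq_zero, three_eq_one_zmod_two]
  rw [e]; decide

/-- **`BSD(E_{59}, 2)`** (`y² = x³ − 59²x`, class `111392b1`), journal door: Monsky (`hM`) + Burungale–Tian (`hBT`) + Deuring–Hecke (`hH`) + Burungale–Flach (`hBF`); membership `s(59) = 0` by `det_monskyMatrixOdd_59`. [cite: BurungaleTian2026, Thm. 1.1] [cite: BurungaleFlach2024, Cor. 2] [cite: Miller2011LMS, Def. 1.1] -/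
theorem bsdp_two_congruentNumberCurve_59 (hM : monsky_card_selmerGroup_two_odd)
    (hBT : burungaleTian_analyticRank_eq_zero_of_selmerCorank_eq_zero_of_hasCM)
    (hH : hasEntireLFunction_of_j_mem_maximalCMJInvariants)
    (hBF : bsdTriple_of_hasCM_of_L_one_ne_zero) : BSDp (congruentNumberCurve 59) 2 :=
  bsdp_two_congruentNumberCurve_of_det_odd ![59] hM hBT hH hBF
    (by intro i; fin_cases i; norm_num) (by intro i; fin_cases i; decide) (by decide)
    det_monskyMatrixOdd_59 (by simp)

/-- `n = 67` = 67: `n ≡ 3 (mod 8)`, Cremona class of `E_{67}` = `143648c1` (`N = 143648`); Monsky's matrix (odd case, `k = 1`) has rows `11;10` and `det M = 1`, i.e. `s(67) = 0`. [cite: HeathBrown1994SelmerCongruentII, Appendix (Monsky), typescript p. 39 L10–L33] -/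
theorem det_monskyMatrixOdd_67 : (monskyMatrixOdd ![67]).det = 1 := by
  have e : monskyMatrixOdd ![67] =
      Matrix.fromBlocks !![1] !![1] !![1] !![0] := by
    ext i j
    fin_cases i <;> fin_cases j <;>
      norm_num [monskyMatrixOdd, legendreMatrix, legendreDiagonal, addLegendreSym,
        Matrix.fromBlocks, Finset.sum_erase_eq_sub, Fin.sum_univ_succ, Matrix.cons_val_succ,
        Matrix.cons_val_zero, CharTwo.two_eq_zero, three_eq_one_zmod_two]
  rw [e]; decide

/-- **`BSD(E_{67}, 2)`** (`y² = x³ − 67²x`, class `143648c1`), journal door: Monsky (`hM`) + Burungale–Tian (`hBT`) + Deuring–Hecke (`hH`) + Burungale–Flach (`hBF`); membership `s(67) = 0` by `det_monskyMatrixOdd_67`. [cite: BurungaleTian2026, Thm. 1.1] [cite: BurungaleFlach2024, Cor. 2] [cite: Miller2011LMS, Def. 1.1] -/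
theorem bsdp_two_congruentNumberCurve_67 (hM : monsky_card_selmerGroup_two_odd)
    (hBT : burungaleTian_analyticRank_eq_zero_of_selmerCorank_eq_zero_of_hasCM)
    (hH : hasEntireLFunction_of_j_mem_maximalCMJInvariants)
    (hBF : bsdTriple_of_hasCM_of_L_one_ne_zero) : BSDp (congruentNumberCurve 67) 2 :=
  bsdp_two_congruentNumberCurve_of_det_odd ![67] hM hBT hH hBF
    (by intro i; fin_cases i; norm_num) (by intro i; fin_cases i; decide) (by decide)
    det_monskyMatrixOdd_67 (by simp)

/-- `n = 83` = 83: `n ≡ 3 (mod 8)`, Cremona class of `E_{83}` = `220448g1` (`N = 220448`); Monsky's matrix (odd case, `k = 1`) has rows `11;10` and `det M = 1`, i.e. `s(83) = 0`. [cite: HeathBrown1994SelmerCongruentII, Appendix (Monsky), typescript p. 39 L10–L33] -/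
theorem det_monskyMatrixOdd_83 : (monskyMatrixOdd ![83]).det = 1 := by
  have e : monskyMatrixOdd ![83] =
      Matrix.fromBlocks !![1] !![1] !![1] !![0] := by
    ext i j
    fin_cases i <;> fin_cases j <;>
      norm_num [monskyMatrixOdd, legendreMatrix, legendreDiagonal, addLegendreSym,
        Matrix.fromBlocks, Finset.sum_erase_eq_sub, Fin.sum_univ_succ, Matrix.cons_val_succ,
        Matrix.cons_val_zero, CharTwo.two_eq_zero, three_eq_one_zmod_two]
  rw [e]; decide

/-- **`BSD(E_{83}, 2)`** (`y² = x³ − 83²x`, class `220448g1`), journal door: Monsky (`hM`) + Burungale–Tian (`hBT`) + Deuring–Hecke (`hH`) + Burungale–Flach (`hBF`); membership `s(83) = 0` by `det_monskyMatrixOdd_83`. [cite: BurungaleTian2026, Thm. 1.1] [cite: BurungaleFlach2024, Cor. 2] [cite: Miller2011LMS, Def. 1.1] -/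
theorem bsdp_two_congruentNumberCurve_83 (hM : monsky_card_selmerGroup_two_odd)
    (hBT : burungaleTian_analyticRank_eq_zero_of_selmerCorank_eq_zero_of_hasCM)
    (hH : hasEntireLFunction_of_j_mem_maximalCMJInvariants)
    (hBF : bsdTriple_of_hasCM_of_L_one_ne_zero) : BSDp (congruentNumberCurve 83) 2 :=
  bsdp_two_congruentNumberCurve_of_det_odd ![83] hM hBT hH hBF
    (by intro i; fin_cases i; norm_num) (by intro i; fin_cases i; decide) (by decide)
    det_monskyMatrixOdd_83 (by simp)

/-- `n = 91` = 7 · 13: `n ≡ 3 (mod 8)`, Cremona class of `E_{91}` = `264992by1` (`N = 264992`); Monsky's matrix (odd case, `k = 2`) has rows `1100;1001;0001;0110` and `det M = 1`, i.e. `s(91) = 0`. [cite: HeathBrown1994SelmerCongruentII, Appendix (Monsky), typescript p. 39 L10–L33] -/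
theorem det_monskyMatrixOdd_91 : (monskyMatrixOdd ![7, 13]).det = 1 := by
  have e : monskyMatrixOdd ![7, 13] =
      Matrix.fromBlocks !![1, 1; 1, 0] !![0, 0; 0, 1] !![0, 0; 0, 1] !![0, 1; 1, 0] := by
    ext i j
    fin_cases i <;> fin_cases j <;>
      norm_num [monskyMatrixOdd, legendreMatrix, legendreDiagonal, addLegendreSym,
        Matrix.fromBlocks, Finset.sum_erase_eq_sub, Fin.sum_univ_succ, Matrix.cons_val_succ,
        Matrix.cons_val_zero, CharTwo.two_eq_zero, three_eq_one_zmod_two] <;> decide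
  rw [e]; decide

/-- **`BSD(E_{91}, 2)`** (`y² = x³ − 91²x`, class `264992by1`), journal door: Monsky (`hM`) + Burungale–Tian (`hBT`) + Deuring–Hecke (`hH`) + Burungale–Flach (`hBF`); membership `s(91) = 0` by `det_monskyMatrixOdd_91`. [cite: BurungaleTian2026, Thm. 1.1] [cite: BurungaleFlach2024, Cor. 2] [cite: Miller2011LMS, Def. 1.1] -/
theorem bsdp_two_congruentNumberCurve_91 (hM : monsky_card_selmerGroup_two_odd)
    (hBT : burungaleTian_analyticRank_eq_zero_of_selmerCorank_eq_zero_of_hasCM)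
    (hH : hasEntireLFunction_of_j_mem_maximalCMJInvariants)
    (hBF : bsdTriple_of_hasCM_of_L_one_ne_zero) : BSDp (congruentNumberCurve 91) 2 :=
  bsdp_two_congruentNumberCurve_of_det_odd ![7, 13] hM hBT hH hBF
    (by intro i; fin_cases i <;> norm_num) (by intro i; fin_cases i <;> decide) (by decide)
    det_monskyMatrixOdd_91 (by simp [Fin.prod_univ_succ])

set_option maxRecDepth 20000 in
/-- `n = 105` = 3 · 5 · 7: `n ≡ 1 (mod 8)`, Cremona class of `E_{105}` = `352800ja1` (`N = 352800`); Monsky's matrix (odd case, `k = 3`) has rows `010100;111010;110000;100110;010111;000111` and `det M = 1`, i.e. `s(105) = 0`. [cite: HeathBrown1994SelmerCongruentII, Appendix (Monsky), typescript p. 39 L10–L33] -/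
theorem det_monskyMatrixOdd_105 : (monskyMatrixOdd ![3, 5, 7]).det = 1 := by
  have e : monskyMatrixOdd ![3, 5, 7] =
      Matrix.fromBlocks !![0, 1, 0; 1, 1, 1; 1, 1, 0] !![1, 0, 0; 0, 1, 0; 0, 0, 0] !![1, 0, 0; 0, 1, 0; 0, 0, 0] !![1, 1, 0; 1, 1, 1; 1, 1, 1] := by
    ext i j
    fin_cases i <;> fin_cases j <;>
      norm_num [monskyMatrixOdd, legendreMatrix, legendreDiagonal, addLegendreSym,
        Matrix.fromBlocks, Finset.sum_erase_eq_sub, Fin.sum_univ_succ, Matrix.cons_val_succ,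
        Matrix.cons_val_zero, CharTwo.two_eq_zero, three_eq_one_zmod_two] <;> decide
  rw [e]; decide

/-- **`BSD(E_{105}, 2)`** (`y² = x³ − 105²x`, class `352800ja1`), journal door: Monsky (`hM`) + Burungale–Tian (`hBT`) + Deuring–Hecke (`hH`) + Burungale–Flach (`hBF`); membership `s(105) = 0` by `det_monskyMatrixOdd_105`. [cite: BurungaleTian2026, Thm. 1.1] [cite: BurungaleFlach2024, Cor. 2] [cite: Miller2011LMS, Def. 1.1] -/
theorem bsdp_two_congruentNumberCurve_105 (hM : monsky_card_selmerGroup_two_odd)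
    (hBT : burungaleTian_analyticRank_eq_zero_of_selmerCorank_eq_zero_of_hasCM)
    (hH : hasEntireLFunction_of_j_mem_maximalCMJInvariants)
    (hBF : bsdTriple_of_hasCM_of_L_one_ne_zero) : BSDp (congruentNumberCurve 105) 2 :=
  bsdp_two_congruentNumberCurve_of_det_odd ![3, 5, 7] hM hBT hH hBF
    (by intro i; fin_cases i <;> norm_num) (by intro i; fin_cases i <;> decide) (by decide)
    det_monskyMatrixOdd_105 (by simp [Fin.prod_univ_succ])

/-- `n = 107` = 107: `n ≡ 3 (mod 8)`, Cremona class of `E_{107}` = `366368i1` (`N = 366368`); Monsky's matrix (odd case, `k = 1`) has rows `11;10` and `det M = 1`, i.e. `s(107) = 0`. [cite: HeathBrown1994SelmerCongruentII, Appendix (Monsky), typescript p. 39 L10–L33] -/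
theorem det_monskyMatrixOdd_107 : (monskyMatrixOdd ![107]).det = 1 := by
  have e : monskyMatrixOdd ![107] =
      Matrix.fromBlocks !![1] !![1] !![1] !![0] := by
    ext i j
    fin_cases i <;> fin_cases j <;>
      norm_num [monskyMatrixOdd, legendreMatrix, legendreDiagonal, addLegendreSym,
        Matrix.fromBlocks, Finset.sum_erase_eq_sub, Fin.sum_univ_succ, Matrix.cons_val_succ,
        Matrix.cons_val_zero, CharTwo.two_eq_zero, three_eq_one_zmod_two]
  rw [e]; decide

/-- **`BSD(E_{107}, 2)`** (`y² = x³ − 107²x`, class `366368i1`), journal door: Monsky (`hM`) + Burungale–Tian (`hBT`) + Deuring–Hecke (`hH`) + Burungale–Flach (`hBF`); membership `s(107) = 0` by `det_monskyMatrixOdd_107`. [cite: BurungaleTian2026, Thm. 1.1] [cite: BurungaleFlach2024, Cor. 2] [cite: Miller2011LMS, Def. 1.1] -/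
theorem bsdp_two_congruentNumberCurve_107 (hM : monsky_card_selmerGroup_two_odd)
    (hBT : burungaleTian_analyticRank_eq_zero_of_selmerCorank_eq_zero_of_hasCM)
    (hH : hasEntireLFunction_of_j_mem_maximalCMJInvariants)
    (hBF : bsdTriple_of_hasCM_of_L_one_ne_zero) : BSDp (congruentNumberCurve 107) 2 :=
  bsdp_two_congruentNumberCurve_of_det_odd ![107] hM hBT hH hBF
    (by intro i; fin_cases i; norm_num) (by intro i; fin_cases i; decide) (by decide)
    det_monskyMatrixOdd_107 (by simp)

/-- `n = 115` = 5 · 23: `n ≡ 3 (mod 8)`, Cremona class of `E_{115}` = `423200bb1` (`N = 423200`); Monsky's matrix (odd case, `k = 2`) has rows `0110;1100;1001;0010` and `det M = 1`, i.e. `s(115) = 0`. [cite: HeathBrown1994SelmerCongruentII, Appendix (Monsky), typescript p. 39 L10–L33] -/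
theorem det_monskyMatrixOdd_115 : (monskyMatrixOdd ![5, 23]).det = 1 := by
  have e : monskyMatrixOdd ![5, 23] =
      Matrix.fromBlocks !![0, 1; 1, 1] !![1, 0; 0, 0] !![1, 0; 0, 0] !![0, 1; 1, 0] := by
    ext i j
    fin_cases i <;> fin_cases j <;>
      norm_num [monskyMatrixOdd, legendreMatrix, legendreDiagonal, addLegendreSym,
        Matrix.fromBlocks, Finset.sum_erase_eq_sub, Fin.sum_univ_succ, Matrix.cons_val_succ,
        Matrix.cons_val_zero, CharTwo.two_eq_zero, three_eq_one_zmod_two] <;> decide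
  rw [e]; decide

/-- **`BSD(E_{115}, 2)`** (`y² = x³ − 115²x`, class `423200bb1`), journal door: Monsky (`hM`) + Burungale–Tian (`hBT`) + Deuring–Hecke (`hH`) + Burungale–Flach (`hBF`); membership `s(115) = 0` by `det_monskyMatrixOdd_115`. [cite: BurungaleTian2026, Thm. 1.1] [cite: BurungaleFlach2024, Cor. 2] [cite: Miller2011LMS, Def. 1.1] -/
theorem bsdp_two_congruentNumberCurve_115 (hM : monsky_card_selmerGroup_two_odd)
    (hBT : burungaleTian_analyticRank_eq_zero_of_selmerCorank_eq_zero_of_hasCM)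
    (hH : hasEntireLFunction_of_j_mem_maximalCMJInvariants)
    (hBF : bsdTriple_of_hasCM_of_L_one_ne_zero) : BSDp (congruentNumberCurve 115) 2 :=
  bsdp_two_congruentNumberCurve_of_det_odd ![5, 23] hM hBT hH hBF
    (by intro i; fin_cases i <;> norm_num) (by intro i; fin_cases i <;> decide) (by decide)
    det_monskyMatrixOdd_115 (by simp [Fin.prod_univ_succ])

/-- `n = 123` = 3 · 41: `n ≡ 3 (mod 8)`, Cremona class of `E_{123}` = `484128bm1` (`N = 484128`); Monsky's matrix (odd case, `k = 2`) has rows `0110;1100;1011;0011` and `det M = 1`, i.e. `s(123) = 0`. [cite: HeathBrown1994SelmerCongruentII, Appendix (Monsky), typescript p. 39 L10–L33] -/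
theorem det_monskyMatrixOdd_123 : (monskyMatrixOdd ![3, 41]).det = 1 := by
  have e : monskyMatrixOdd ![3, 41] =
      Matrix.fromBlocks !![0, 1; 1, 1] !![1, 0; 0, 0] !![1, 0; 0, 0] !![1, 1; 1, 1] := by
    ext i j
    fin_cases i <;> fin_cases j <;>
      norm_num [monskyMatrixOdd, legendreMatrix, legendreDiagonal, addLegendreSym,
        Matrix.fromBlocks, Finset.sum_erase_eq_sub, Fin.sum_univ_succ, Matrix.cons_val_succ,
        Matrix.cons_val_zero, CharTwo.two_eq_zero, three_eq_one_zmod_two]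
    decide
  rw [e]; decide

/-- **`BSD(E_{123}, 2)`** (`y² = x³ − 123²x`, class `484128bm1`), journal door: Monsky (`hM`) + Burungale–Tian (`hBT`) + Deuring–Hecke (`hH`) + Burungale–Flach (`hBF`); membership `s(123) = 0` by `det_monskyMatrixOdd_123`. [cite: BurungaleTian2026, Thm. 1.1] [cite: BurungaleFlach2024, Cor. 2] [cite: Miller2011LMS, Def. 1.1] -/
theorem bsdp_two_congruentNumberCurve_123 (hM : monsky_card_selmerGroup_two_odd)
    (hBT : burungaleTian_analyticRank_eq_zero_of_selmerCorank_eq_zero_of_hasCM)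
    (hH : hasEntireLFunction_of_j_mem_maximalCMJInvariants)
    (hBF : bsdTriple_of_hasCM_of_L_one_ne_zero) : BSDp (congruentNumberCurve 123) 2 :=
  bsdp_two_congruentNumberCurve_of_det_odd ![3, 41] hM hBT hH hBF
    (by intro i; fin_cases i <;> norm_num) (by intro i; fin_cases i <;> decide) (by decide)
    det_monskyMatrixOdd_123 (by simp [Fin.prod_univ_succ])

/-- **ROLL-UP (odd `n`)**: `BSD(E_n, 2)` for every odd `n ∈ U_CN` with `s(n) = 0` — the list `[1, 3, 11, 19, 33, 35, 43, 51, 57, 59, 67, 83, 91, 105, 107, 115, 123]` (17 pairs), journal door. [cite: BurungaleTian2026, Thm. 1.1] [cite: BurungaleFlach2024, Cor. 2] [cite: Miller2011LMS, Def. 1.1] -/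
theorem bsdp_two_congruentNumberCurve_of_mem_oddList (hM : monsky_card_selmerGroup_two_odd)
    (hT : burungaleTian_analyticRank_eq_zero_of_selmerCorank_eq_zero_of_hasCM)
    (hH : hasEntireLFunction_of_j_mem_maximalCMJInvariants)
    (hF : bsdTriple_of_hasCM_of_L_one_ne_zero) :
    ∀ n ∈ ([1, 3, 11, 19, 33, 35, 43, 51, 57, 59, 67, 83, 91, 105, 107, 115, 123] : List ℕ), BSDp (congruentNumberCurve n) 2 := by
  intro n hn
  simp only [List.mem_cons, List.not_mem_nil, or_false] at hn
  rcases hn with rfl | rfl | rfl | rfl | rfl | rfl | rfl | rfl | rfl | rfl | rfl | rfl | rfl | rfl | rfl | rfl | rfl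
  exacts [bsdp_two_congruentNumberCurve_1 hM hT hH hF, bsdp_two_congruentNumberCurve_3 hM hT hH hF,
    bsdp_two_congruentNumberCurve_11 hM hT hH hF, bsdp_two_congruentNumberCurve_19 hM hT hH hF,
    bsdp_two_congruentNumberCurve_33 hM hT hH hF, bsdp_two_congruentNumberCurve_35 hM hT hH hF,
    bsdp_two_congruentNumberCurve_43 hM hT hH hF, bsdp_two_congruentNumberCurve_51 hM hT hH hF,
    bsdp_two_congruentNumberCurve_57 hM hT hH hF, bsdp_two_congruentNumberCurve_59 hM hT hH hF,
    bsdp_two_congruentNumberCurve_67 hM hT hH hF, bsdp_two_congruentNumberCurve_83 hM hT hH hF,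
    bsdp_two_congruentNumberCurve_91 hM hT hH hF, bsdp_two_congruentNumberCurve_105 hM hT hH hF,
    bsdp_two_congruentNumberCurve_107 hM hT hH hF, bsdp_two_congruentNumberCurve_115 hM hT hH hF,
    bsdp_two_congruentNumberCurve_123 hM hT hH hF]

end Summit.BirchSwinnertonDyer.Rank1Residual.P2

end
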